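import Literature.NumberTheory.EllipticCurves.TwoDescentKummerBridgeRat
import Literature.NumberTheory.EllipticCurves.TwoDescentLocalAdditive
import HarnessLib

/-!
# Selmer classes at an odd place of additive type (`I₀*`): the pair of components is a torsion class

Second half of the local bookkeeping of the complete `2`-descent on Selmer classes (Silverman,
*AEC*, Prop. X.1.4 with Prop. X.4.9), after the good odd places
(`TwoDescentKummerBridgeGoodPlace.lean`, `TwoDescentKummerBridgeRat.lean`). At an odd place `v` of
ADDITIVE type for a curve with rational `2`-torsion — all three differences of the roots have
valuation exactly `1`, `v(e₁ - e₂) = v(e₁ - e₃) = v(e₂ - e₃) = 1` (Kodaira type `I₀*`; the odd primes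
`p ∣ n` of the congruent number curves `y² = x³ - n²x`) — the PAIR of descent components
`(x(P) - e₁, x(P) - e₂)` of every point `P ∈ E(K_v)` satisfies the two `𝔽₂`-linear relations of
`TwoDescentLocalAdditive.local_conditions_of_add` between its residue bits and its parity bits,
i.e. lies in the image `{δ(O), δ(T₁), δ(T₂), δ(T₃)}` of the `2`-torsion. This file carries the
relations over to Selmer classes:

* `exists_twoDescentComponent_pair_eq_of_mem_kummerLocalConditionAt`, `…_of_res_mem`,
  `…_of_mem_selmerGroup` — the JOINT form of the local descent–Kummer bridge of
  `TwoDescentKummerBridgeLocal.lean`: ONE local point `P ∈ E(K_v)` whose `T₁`- AND `T₂`-components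
  are the localised global components `[a]_v`, `[b]_v` of the class (the same preimage under the
  local Kummer map serves both characters `χ₁ = e₂(·, T₁)`, `χ₂ = e₂(·, T₂)`);
* `OddPlace.local_conditions_of_add_of_twoDescentComponent_eq` — the relations of
  `local_conditions_of_add` for ALL points (the `2`-torsion and `O` included), phrased on
  representatives `a, b` of the two descent components, over any field with an abstract odd place;
* `adicOddPlace_χ_algebraMap`, `adicOddPlace_parity_algebraMap` — on rationals the residue / parity
  bits of `adicOddPlace v` (`TwoDescentKummerBridgeRat.lean`) are the tree's `qrBit ℓ`, `parityBit ℓ`;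
* `qrBit_eq_of_mem_selmerGroup_of_add` — **for `E/ℚ` with rational `2`-torsion, `c ∈ Sel⁽²⁾(E/ℚ)`
  with global components `[a]`, `[b]` (`a, b ∈ ℚˣ`) and an odd prime `ℓ` with
  `v_ℓ(e₁ - e₂) = v_ℓ(e₁ - e₃) = v_ℓ(e₂ - e₃) = 1`:
  `qrBit ℓ a = parityBit ℓ a · qrBit ℓ (e₂ - e₁) + parityBit ℓ b · qrBit ℓ ((e₁ - e₂)(e₁ - e₃))` and
  `qrBit ℓ b = parityBit ℓ a · qrBit ℓ ((e₂ - e₁)(e₂ - e₃)) + parityBit ℓ b · qrBit ℓ (e₁ - e₂)`** —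
  the two linear conditions at `ℓ` of a `2`-Selmer computation, in the currency of the tree's rank
  computations (`CongruentNumberEvenFiveThreeRankBound.lean`).

Theorems only; no named fact. Cell `bsd-monsky` (towards `#Sel⁽²⁾(E_{2pq}/ℚ) ≤ 8` as a kernel
theorem: the places `p` and `q`).

## References

* [SilvermanAEC2009] J. H. Silverman, *The Arithmetic of Elliptic Curves*, 2nd ed., GTM 106,
  Springer 2009, Thm. X.1.1, Prop. X.1.4 (and its proof), X.§4 diagram (**), Prop. X.4.9.
-/

noncomputable section

open scoped Classical

open WeierstrassCurve.Affine WeierstrassCurve.Affine.Point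

/-! ## The relations of an additive odd place on descent components (any field) -/

namespace Literature.NumberTheory.EllipticCurves.TwoDescentLocal.OddPlace

variable {F : Type*} [Field F] (𝔳 : OddPlace F)

/-- Equal square classes have equal residue bits (the residue character of `Fˣ/Fˣ²`).
[cite: SilvermanAEC2009, X.§1 (Example X.1.5)] -/
theorem χ_eq_of_sqClass_eq {a r : F} (ha : a ≠ 0) (hr : r ≠ 0) (h : sqClass a = sqClass r) :
    𝔳.χ a = 𝔳.χ r := by
  rw [← 𝔳.χHom_sqClass ha, ← 𝔳.χHom_sqClass hr, h]

/-- Equal square classes have equal parity bits (the parity character of `Fˣ/Fˣ²`).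
[cite: SilvermanAEC2009, X.§1 (Example X.1.5)] -/
theorem parity_eq_of_sqClass_eq {a r : F} (ha : a ≠ 0) (hr : r ≠ 0) (h : sqClass a = sqClass r) :
    𝔳.parity a = 𝔳.parity r := by
  rw [← 𝔳.parityHom_sqClass ha, ← 𝔳.parityHom_sqClass hr, h]

/-- A square class equal to `1` has trivial residue and parity bits.
[cite: SilvermanAEC2009, X.§1 (Example X.1.5)] -/
theorem χ_parity_eq_zero_of_sqClass_eq_one {a : F} (ha : a ≠ 0) (h : sqClass a = 1) :
    𝔳.χ a = 0 ∧ 𝔳.parity a = 0 := by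
  have h1 : sqClass a = sqClass (1 : F) := by rw [h, ← mul_one (1 : F), sqClass_mul_self]
  exact ⟨(𝔳.χ_eq_of_sqClass_eq ha one_ne_zero h1).trans 𝔳.χ_one,
    (𝔳.parity_eq_of_sqClass_eq ha one_ne_zero h1).trans
      ((𝔳.parity_eq_zero_iff 1).mpr (by rw [𝔳.v_one]; exact ⟨0, rfl⟩))⟩

variable {𝔳}
variable [CharZero F] {W : WeierstrassCurve.Affine F} [W.IsElliptic] {e₁ e₂ e₃ : F}

/-- **The local conditions at an odd place of additive type, on descent components** (Silverman
AEC Prop. X.1.4 at a prime of type `I₀*`): let `𝔳` be an odd place of `F`, `E/F` a curve with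
rational `2`-torsion `e₁, e₂, e₃` and `v(e₁ - e₂) = v(e₁ - e₃) = v(e₂ - e₃) = 1`. If `a, b ∈ F`,
non-zero, represent the `T₁`- and `T₂`-descent components of a point `P ∈ E(F)` (`O` and the
`2`-torsion included), then
`χ(a) = parity(a)·χ(e₂ - e₁) + parity(b)·χ((e₁ - e₂)(e₁ - e₃))` and
`χ(b) = parity(a)·χ((e₂ - e₁)(e₂ - e₃)) + parity(b)·χ(e₁ - e₂)` — the pair of local square classes of
`(a, b)` is one of `δ(O), δ(T₁), δ(T₂), δ(T₃)`. [cite: SilvermanAEC2009, Prop. X.1.4] -/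
theorem local_conditions_of_add_of_twoDescentComponent_eq (h : W.SplitTwoTorsion e₁ e₂ e₃)
    (h₁₂ : 𝔳.v (e₁ - e₂) = 1) (h₁₃ : 𝔳.v (e₁ - e₃) = 1) (h₂₃ : 𝔳.v (e₂ - e₃) = 1) (P : W.Point)
    {a b : F} (ha : a ≠ 0) (hb : b ≠ 0) (hPa : twoDescentComponent W e₁ e₂ e₃ P = sqClass a)
    (hPb : twoDescentComponent W e₂ e₁ e₃ P = sqClass b) :
    𝔳.χ a = 𝔳.parity a * 𝔳.χ (e₂ - e₁) + 𝔳.parity b * 𝔳.χ ((e₁ - e₂) * (e₁ - e₃)) ∧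
      𝔳.χ b = 𝔳.parity a * 𝔳.χ ((e₂ - e₁) * (e₂ - e₃)) + 𝔳.parity b * 𝔳.χ (e₁ - e₂) := by
  have he₁₂ : e₁ - e₂ ≠ 0 := sub_ne_zero.mpr h.ne₁₂
  have he₁₃ : e₁ - e₃ ≠ 0 := sub_ne_zero.mpr h.ne₁₃
  have he₂₁ : e₂ - e₁ ≠ 0 := sub_ne_zero.mpr (Ne.symm h.ne₁₂)
  have he₂₃ : e₂ - e₃ ≠ 0 := sub_ne_zero.mpr h.ne₂₃
  have he₃₁ : e₃ - e₁ ≠ 0 := sub_ne_zero.mpr (Ne.symm h.ne₁₃)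
  have he₃₂ : e₃ - e₂ ≠ 0 := sub_ne_zero.mpr (Ne.symm h.ne₂₃)
  -- parity values of the constants
  have p0 : ∀ {t : F}, Even (𝔳.v t) → 𝔳.parity t = 0 := fun ht => (𝔳.parity_eq_zero_iff _).mpr ht
  have p1 : ∀ {t : F}, 𝔳.v t = 1 → 𝔳.parity t = 1 := fun ht =>
    𝔳.parity_eq_one_of_not_even (by rw [ht]; exact Int.not_even_one)
  have hv₂₁ : 𝔳.v (e₂ - e₁) = 1 := by rw [𝔳.v_sub_comm, h₁₂]
  have hv₃₁ : 𝔳.v (e₃ - e₁) = 1 := by rw [𝔳.v_sub_comm, h₁₃]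
  have hv₃₂ : 𝔳.v (e₃ - e₂) = 1 := by rw [𝔳.v_sub_comm, h₂₃]
  have hpc₁ : 𝔳.parity ((e₁ - e₂) * (e₁ - e₃)) = 0 :=
    p0 (by rw [𝔳.v_mul he₁₂ he₁₃, h₁₂, h₁₃]; exact ⟨1, rfl⟩)
  have hpc₂ : 𝔳.parity ((e₂ - e₁) * (e₂ - e₃)) = 0 :=
    p0 (by rw [𝔳.v_mul he₂₁ he₂₃, hv₂₁, h₂₃]; exact ⟨1, rfl⟩)
  rcases P with _ | ⟨x, y, hP⟩
  · -- `P = O`: both components trivial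
    rw [← zero_def, twoDescentComponent_zero, eq_comm] at hPa hPb
    obtain ⟨hχa, hpa⟩ := 𝔳.χ_parity_eq_zero_of_sqClass_eq_one ha hPa
    obtain ⟨hχb, hpb⟩ := 𝔳.χ_parity_eq_zero_of_sqClass_eq_one hb hPb
    simp only [hχa, hpa, hχb, hpb, zero_mul, add_zero, and_self]
  by_cases hx₁ : x = e₁
  · -- `P = T₁`: `a ~ (e₁ - e₂)(e₁ - e₃)`, `b ~ e₁ - e₂`
    rw [twoDescentComponent_some_of_eq hP hx₁, eq_comm] at hPa
    rw [twoDescentComponent_some_of_ne hP (by rw [hx₁]; exact h.ne₁₂), eq_comm, hx₁] at hPb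
    rw [𝔳.χ_eq_of_sqClass_eq ha h.c_ne_zero hPa, 𝔳.parity_eq_of_sqClass_eq ha h.c_ne_zero hPa,
      𝔳.χ_eq_of_sqClass_eq hb he₁₂ hPb, 𝔳.parity_eq_of_sqClass_eq hb he₁₂ hPb, hpc₁, p1 h₁₂,
      zero_mul, zero_mul, one_mul, one_mul, zero_add, zero_add]
    exact ⟨rfl, rfl⟩
  by_cases hx₂ : x = e₂
  · -- `P = T₂`: `a ~ e₂ - e₁`, `b ~ (e₂ - e₁)(e₂ - e₃)`
    rw [twoDescentComponent_some_of_ne hP hx₁, eq_comm, hx₂] at hPa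
    rw [twoDescentComponent_some_of_eq hP hx₂, eq_comm] at hPb
    rw [𝔳.χ_eq_of_sqClass_eq ha he₂₁ hPa, 𝔳.parity_eq_of_sqClass_eq ha he₂₁ hPa,
      𝔳.χ_eq_of_sqClass_eq hb h.swap₁₂.c_ne_zero hPb,
      𝔳.parity_eq_of_sqClass_eq hb h.swap₁₂.c_ne_zero hPb, hpc₂, p1 hv₂₁,
      zero_mul, zero_mul, one_mul, one_mul, add_zero, add_zero]
    exact ⟨rfl, rfl⟩
  -- `x ≠ e₁, e₂`: `a ~ x - e₁`, `b ~ x - e₂`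
  rw [twoDescentComponent_some_of_ne hP hx₁, eq_comm] at hPa
  rw [twoDescentComponent_some_of_ne hP hx₂, eq_comm] at hPb
  have hxe₁ : x - e₁ ≠ 0 := sub_ne_zero.mpr hx₁
  have hxe₂ : x - e₂ ≠ 0 := sub_ne_zero.mpr hx₂
  rw [𝔳.χ_eq_of_sqClass_eq ha hxe₁ hPa, 𝔳.parity_eq_of_sqClass_eq ha hxe₁ hPa,
    𝔳.χ_eq_of_sqClass_eq hb hxe₂ hPb, 𝔳.parity_eq_of_sqClass_eq hb hxe₂ hPb]
  have hsq := sq_eq_mul_mul_of_equation h hP.1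
  by_cases hy : y + (W.a₁ * x + W.a₃) / 2 = 0
  · -- `P = T₃`: `x = e₃`
    rw [hy, zero_pow two_ne_zero, eq_comm, mul_eq_zero, mul_eq_zero] at hsq
    have hx₃ : x = e₃ := by
      rcases hsq with (h0 | h0) | h0
      · exact absurd (sub_eq_zero.mp h0) hx₁
      · exact absurd (sub_eq_zero.mp h0) hx₂
      · exact sub_eq_zero.mp h0
    rw [hx₃]
    have n₁₂ := 𝔳.χ_add_χ_neg he₁₂
    have n₁₃ := 𝔳.χ_add_χ_neg he₁₃
    have n₂₃ := 𝔳.χ_add_χ_neg he₂₃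
    rw [neg_sub] at n₁₂ n₁₃ n₂₃
    rw [p1 hv₃₁, p1 hv₃₂, 𝔳.χ_mul he₁₂ he₁₃, 𝔳.χ_mul he₂₁ he₂₃, one_mul, one_mul, one_mul, one_mul]
    revert n₁₂ n₁₃ n₂₃
    generalize 𝔳.χ (e₁ - e₂) = a₁; generalize 𝔳.χ (e₂ - e₁) = a₂; generalize 𝔳.χ (e₁ - e₃) = a₃
    generalize 𝔳.χ (e₃ - e₁) = a₄; generalize 𝔳.χ (e₂ - e₃) = a₅; generalize 𝔳.χ (e₃ - e₂) = a₆
    generalize 𝔳.χ (-1) = c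
    revert a₁ a₂ a₃ a₄ a₅ a₆ c; decide
  · exact local_conditions_of_add h₁₂ h₁₃ h₂₃ h.ne₁₂ h.ne₁₃ h.ne₂₃ hy hsq

end Literature.NumberTheory.EllipticCurves.TwoDescentLocal.OddPlace

/-! ## The joint local descent–Kummer bridge: one local point for both components -/

open Field

universe u

namespace WeierstrassCurve

open Literature.NumberTheory.GaloisRepresentations Literature.NumberTheory.EllipticCurves
open Literature.NumberTheory.EllipticCurves.TwoDescentLocal WeierstrassCurve.Affine

variable {K : Type u} [Field K] [CharZero K] (W : WeierstrassCurve K) [W.IsElliptic] {e₁ e₂ e₃ : K}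
variable (E : Type u) [Field E] [Algebra K E] [CharZero E]

/-- **The local Kummer image is the descent image — jointly for `T₁` and `T₂`** (Silverman AEC
X.1.4 at the completion): every class `c` of the local Kummer condition
`𝓛_E = kummerLocalConditionAt W 2 E` is `localKummerMap P` for one `P ∈ (W⁄E)(E)`, and then BOTH its
`T₁`-component (restricted character of `h`) and its `T₂`-component (restricted character of
`h.swap₁₂`), read in `Eˣ/Eˣ²`, are the descent components `x(P) - e₁`, `x(P) - e₂` of that same
point. [cite: SilvermanAEC2009, Thm. X.1.1, Prop. X.1.4, X.§4 diagram (**)] -/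
theorem exists_kummerEquiv_resTwoTorsionCharH1_pair_eq_of_mem_kummerLocalConditionAt
    (h : W.toAffine.SplitTwoTorsion e₁ e₂ e₃) [(W.baseChange E).IsElliptic]
    {c : galoisCohomology (GaloisRep.restrictField E (W.torsionGaloisModule 2)) 1}
    (hc : c ∈ W.kummerLocalConditionAt 2 E) :
    ∃ P : (W.baseChange E).toAffine.Point,
      kummerEquiv E 2 (W.resTwoTorsionCharH1 E h c) =
          Additive.ofMul (Affine.Point.twoDescentComponent (W.baseChange E).toAffine
            (algebraMap K E e₁) (algebraMap K E e₂) (algebraMap K E e₃) P) ∧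
        kummerEquiv E 2 (W.resTwoTorsionCharH1 E h.swap₁₂ c) =
          Additive.ofMul (Affine.Point.twoDescentComponent (W.baseChange E).toAffine
            (algebraMap K E e₂) (algebraMap K E e₁) (algebraMap K E e₃) P) := by
  rw [← W.range_localKummerMap E (two_ne_zero : (2 : ℤ) ≠ 0), AddMonoidHom.mem_range] at hc
  obtain ⟨P, rfl⟩ := hc
  refine ⟨P, ?_, ?_⟩
  · rw [W.localKummerMap_eq_cohomologyMap_kummerMapTorsion E (two_ne_zero : (2 : ℤ) ≠ 0)
        (W.two_zsmul_geomPoints_baseChange_surjective E) P,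
      W.resTwoTorsionCharH1_cohomologyMap_torsionTransferInvHom E h,
      (W.baseChange E).kummerEquiv_twoTorsionCharH1_kummerMapTorsion (h.map E)]
  · rw [W.localKummerMap_eq_cohomologyMap_kummerMapTorsion E (two_ne_zero : (2 : ℤ) ≠ 0)
        (W.two_zsmul_geomPoints_baseChange_surjective E) P,
      W.resTwoTorsionCharH1_cohomologyMap_torsionTransferInvHom E h.swap₁₂,
      (W.baseChange E).kummerEquiv_twoTorsionCharH1_kummerMapTorsion (h.swap₁₂.map E)]

/-- **Both components of a global class, localised, are descent components of ONE local point**: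
for `c ∈ H¹(K, E[2])` with `res_E c ∈ 𝓛_E` and global components `[a]` (`T₁`) and `[b]` (`T₂`),
`a, b ∈ Kˣ`, there is `P ∈ E(E)` with `x(P) - e₁ ≡ a` and `x(P) - e₂ ≡ b` in `Eˣ/Eˣ²`.
[cite: SilvermanAEC2009, Prop. X.1.4, X.§4 diagram (**)] -/
theorem exists_twoDescentComponent_pair_eq_of_res_mem (h : W.toAffine.SplitTwoTorsion e₁ e₂ e₃)
    [(W.baseChange E).IsElliptic] {c : galH1Torsion W 2}
    (hc : galoisCohomology.res (W.torsionGaloisModule 2) E 1 c ∈ W.kummerLocalConditionAt 2 E)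
    (a b : Kˣ) (ha : kummerEquiv K 2 (W.twoTorsionCharH1 h c) = Additive.ofMul (QuotientGroup.mk a))
    (hb : kummerEquiv K 2 (W.twoTorsionCharH1 h.swap₁₂ c) = Additive.ofMul (QuotientGroup.mk b)) :
    ∃ P : (W.baseChange E).toAffine.Point,
      Affine.Point.twoDescentComponent (W.baseChange E).toAffine
          (algebraMap K E e₁) (algebraMap K E e₂) (algebraMap K E e₃) P =
        QuotientGroup.mk (Units.map (algebraMap K E : K →* E) a) ∧
      Affine.Point.twoDescentComponent (W.baseChange E).toAffine
          (algebraMap K E e₂) (algebraMap K E e₁) (algebraMap K E e₃) P =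
        QuotientGroup.mk (Units.map (algebraMap K E : K →* E) b) := by
  obtain ⟨P, hP₁, hP₂⟩ :=
    W.exists_kummerEquiv_resTwoTorsionCharH1_pair_eq_of_mem_kummerLocalConditionAt E h hc
  have hP₁' : kummerEquiv E 2 (resMu K E 2 (W.twoTorsionCharH1 h c)) =
      Additive.ofMul (Affine.Point.twoDescentComponent (W.baseChange E).toAffine
        (algebraMap K E e₁) (algebraMap K E e₂) (algebraMap K E e₃) P) := by
    rw [← resTwoTorsionCharH1_res]; exact hP₁
  have hP₂' : kummerEquiv E 2 (resMu K E 2 (W.twoTorsionCharH1 h.swap₁₂ c)) =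
      Additive.ofMul (Affine.Point.twoDescentComponent (W.baseChange E).toAffine
        (algebraMap K E e₂) (algebraMap K E e₁) (algebraMap K E e₃) P) := by
    rw [← resTwoTorsionCharH1_res]; exact hP₂
  refine ⟨P, ?_, ?_⟩
  · have hc' : W.twoTorsionCharH1 h c = (kummerEquiv K 2).symm (Additive.ofMul (QuotientGroup.mk a)) := by
      rw [← ha, AddEquiv.symm_apply_apply]
    rw [hc', kummerEquiv_resMu_symm] at hP₁'
    exact Additive.ofMul.injective hP₁'.symm
  · have hc' : W.twoTorsionCharH1 h.swap₁₂ c =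
        (kummerEquiv K 2).symm (Additive.ofMul (QuotientGroup.mk b)) := by
      rw [← hb, AddEquiv.symm_apply_apply]
    rw [hc', kummerEquiv_resMu_symm] at hP₂'
    exact Additive.ofMul.injective hP₂'.symm

open NumberField in
/-- **Selmer classes are locally descent PAIRS**: for a number field `K`, `c ∈ Sel⁽²⁾(E/K)` with
global components `[a]`, `[b]` and a place `v`, there is ONE point `P ∈ E(K_v)` with
`x(P) - e₁ ≡ a`, `x(P) - e₂ ≡ b` in `K_vˣ/K_vˣ²`. [cite: SilvermanAEC2009, Prop. X.1.4, Prop. X.4.9] -/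
theorem exists_twoDescentComponent_pair_eq_of_mem_selmerGroup [NumberField K]
    (h : W.toAffine.SplitTwoTorsion e₁ e₂ e₃) {c : galH1Torsion W 2} (hc : c ∈ selmerGroup W 2)
    (v : Place K) [CharZero (Place.Completion v)] [(W.baseChange (Place.Completion v)).IsElliptic]
    (a b : Kˣ) (ha : kummerEquiv K 2 (W.twoTorsionCharH1 h c) = Additive.ofMul (QuotientGroup.mk a))
    (hb : kummerEquiv K 2 (W.twoTorsionCharH1 h.swap₁₂ c) = Additive.ofMul (QuotientGroup.mk b)) :
    ∃ P : (W.baseChange (Place.Completion v)).toAffine.Point,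
      Affine.Point.twoDescentComponent (W.baseChange (Place.Completion v)).toAffine
          (algebraMap K (Place.Completion v) e₁) (algebraMap K (Place.Completion v) e₂)
          (algebraMap K (Place.Completion v) e₃) P =
        QuotientGroup.mk (Units.map (algebraMap K (Place.Completion v) : K →* Place.Completion v) a) ∧
      Affine.Point.twoDescentComponent (W.baseChange (Place.Completion v)).toAffine
          (algebraMap K (Place.Completion v) e₂) (algebraMap K (Place.Completion v) e₁)
          (algebraMap K (Place.Completion v) e₃) P =
        QuotientGroup.mk (Units.map (algebraMap K (Place.Completion v) : K →* Place.Completion v) b) :=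
  W.exists_twoDescentComponent_pair_eq_of_res_mem (Place.Completion v) h
    ((W.mem_selmerGroup_iff_forall_localization_mem 2 c).mp hc v) a b ha hb

/-! ## Over `ℚ`: the `I₀*` relations in the tree's currency `qrBit`, `parityBit` -/

open IsDedekindDomain NumberField Rat.HeightOneSpectrum
open Literature.NumberTheory.EllipticCurves.KramerTwoDescent

/-- On rationals the residue bit of `adicOddPlace v` is the tree's `qrBit ℓ`, `ℓ = primesEquiv v`.
[cite: SilvermanAEC2009, X.§1 (Example X.1.5)] -/
theorem adicOddPlace_χ_algebraMap (v : HeightOneSpectrum (𝓞 ℚ)) (a : ℚ) :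
    haveI := fact_prime_primesEquiv v
    (adicOddPlace v).χ (algebraMap ℚ (v.adicCompletion ℚ) a) = qrBit (primesEquiv v : ℕ) a := by
  haveI := fact_prime_primesEquiv v
  show (padicPlace (primesEquiv v : ℕ)).χ ((adicCompletion.padicEquiv v).toAlgEquiv.toRingEquiv.toRingHom
    (algebraMap ℚ (v.adicCompletion ℚ) a)) = _
  rw [RingEquiv.toRingHom_eq_coe, RingHom.coe_coe, AlgEquiv.coe_ringEquiv, AlgEquiv.commutes,
    eq_ratCast]
  exact padicPlace_χ_ratCast _ a

/-- On rationals the parity bit of `adicOddPlace v` is the tree's `parityBit ℓ`, `ℓ = primesEquiv v`.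
[cite: SilvermanAEC2009, X.§1 (Example X.1.5)] -/
theorem adicOddPlace_parity_algebraMap (v : HeightOneSpectrum (𝓞 ℚ)) (a : ℚ) :
    haveI := fact_prime_primesEquiv v
    (adicOddPlace v).parity (algebraMap ℚ (v.adicCompletion ℚ) a) = parityBit (primesEquiv v : ℕ) a := by
  haveI := fact_prime_primesEquiv v
  rw [OddPlace.parity_def, adicOddPlace_v_algebraMap, parityBit]

/-- The class of the unit `algebraMap a` (`a ∈ ℚˣ`) in `Eˣ/Eˣ²` is `sqClass (algebraMap a)` (localising a
global square class). [cite: SilvermanAEC2009, Prop. X.1.4, X.§4 diagram (**)] -/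
theorem mk_unitsMap_eq_sqClass {E' : Type*} [Field E'] [Algebra ℚ E'] (a : ℚˣ) :
    (QuotientGroup.mk (Units.map (algebraMap ℚ E' : ℚ →* E') a) : SqUnits E') =
      sqClass (algebraMap ℚ E' (a : ℚ)) := by
  have ha : algebraMap ℚ E' (a : ℚ) ≠ 0 := by
    rw [map_ne_zero_iff _ (algebraMap ℚ E').injective]; exact a.ne_zero
  rw [sqClass_of_ne_zero ha]
  congr 1
  ext
  rw [Units.coe_map, MonoidHom.coe_coe, Units.val_mk0]

/-- **The `I₀*` relations on Selmer classes over `ℚ`** (Silverman AEC Prop. X.1.4 / X.4.9 at an odd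
prime of additive type): let `E/ℚ` have rational `2`-torsion `e₁, e₂, e₃`, let `c ∈ Sel⁽²⁾(E/ℚ)` have
global `T₁`-component `[a]` and `T₂`-component `[b]` (`a, b ∈ ℚˣ`), and let `v` be a finite place
over the odd prime `ℓ = primesEquiv v` with `v_ℓ(e₁ - e₂) = v_ℓ(e₁ - e₃) = v_ℓ(e₂ - e₃) = 1`. Then
`qrBit ℓ a = parityBit ℓ a · qrBit ℓ (e₂ - e₁) + parityBit ℓ b · qrBit ℓ ((e₁ - e₂)(e₁ - e₃))` and
`qrBit ℓ b = parityBit ℓ a · qrBit ℓ ((e₂ - e₁)(e₂ - e₃)) + parityBit ℓ b · qrBit ℓ (e₁ - e₂)`: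
the pair `(a, b)` localises into the image of the `2`-torsion. [cite: SilvermanAEC2009, Prop. X.1.4, Prop. X.4.9] -/
theorem qrBit_eq_of_mem_selmerGroup_of_add (W : WeierstrassCurve ℚ) [W.IsElliptic] {e₁ e₂ e₃ : ℚ}
    (h : W.toAffine.SplitTwoTorsion e₁ e₂ e₃) {c : galH1Torsion W 2} (hc : c ∈ selmerGroup W 2)
    (v : HeightOneSpectrum (𝓞 ℚ))
    (hv₁₂ : haveI := fact_prime_primesEquiv v; padicValRat (primesEquiv v : ℕ) (e₁ - e₂) = 1)
    (hv₁₃ : haveI := fact_prime_primesEquiv v; padicValRat (primesEquiv v : ℕ) (e₁ - e₃) = 1)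
    (hv₂₃ : haveI := fact_prime_primesEquiv v; padicValRat (primesEquiv v : ℕ) (e₂ - e₃) = 1)
    (a b : ℚˣ) (ha : kummerEquiv ℚ 2 (W.twoTorsionCharH1 h c) = Additive.ofMul (QuotientGroup.mk a))
    (hb : kummerEquiv ℚ 2 (W.twoTorsionCharH1 h.swap₁₂ c) = Additive.ofMul (QuotientGroup.mk b)) :
    haveI := fact_prime_primesEquiv v
    qrBit (primesEquiv v : ℕ) (a : ℚ) =
        parityBit (primesEquiv v : ℕ) (a : ℚ) * qrBit (primesEquiv v : ℕ) (e₂ - e₁) +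
          parityBit (primesEquiv v : ℕ) (b : ℚ) * qrBit (primesEquiv v : ℕ) ((e₁ - e₂) * (e₁ - e₃)) ∧
      qrBit (primesEquiv v : ℕ) (b : ℚ) =
        parityBit (primesEquiv v : ℕ) (a : ℚ) * qrBit (primesEquiv v : ℕ) ((e₂ - e₁) * (e₂ - e₃)) +
          parityBit (primesEquiv v : ℕ) (b : ℚ) * qrBit (primesEquiv v : ℕ) (e₁ - e₂) := by
  haveI := fact_prime_primesEquiv v
  haveI : CharZero (Place.Completion (Sum.inr v : Place ℚ)) :=
    charZero_of_injective_algebraMap (algebraMap ℚ (v.adicCompletion ℚ)).injective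
  haveI : (W.baseChange (Place.Completion (Sum.inr v : Place ℚ))).IsElliptic := W.isElliptic_baseChange _
  -- NB: no `CharZero (v.adicCompletion ℚ)` instance before the `algebraMap ℚ (v.adicCompletion ℚ)` terms
  -- below are elaborated (it would switch them to `DivisionRing.toRatAlgebra`); it is introduced last.
  haveI : (W.baseChange (v.adicCompletion ℚ)).IsElliptic := W.isElliptic_baseChange _
  obtain ⟨P, hP₁, hP₂⟩ :=
    W.exists_twoDescentComponent_pair_eq_of_mem_selmerGroup h hc (Sum.inr v : Place ℚ) a b ha hb
  have ha0 : algebraMap ℚ (v.adicCompletion ℚ) (a : ℚ) ≠ 0 := by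
    rw [map_ne_zero_iff _ (algebraMap ℚ (v.adicCompletion ℚ)).injective]; exact a.ne_zero
  have hb0 : algebraMap ℚ (v.adicCompletion ℚ) (b : ℚ) ≠ 0 := by
    rw [map_ne_zero_iff _ (algebraMap ℚ (v.adicCompletion ℚ)).injective]; exact b.ne_zero
  have h12 : (adicOddPlace v).v (algebraMap ℚ (v.adicCompletion ℚ) e₁ -
      algebraMap ℚ (v.adicCompletion ℚ) e₂) = 1 := by
    rw [← map_sub, adicOddPlace_v_algebraMap]; exact hv₁₂
  have h13 : (adicOddPlace v).v (algebraMap ℚ (v.adicCompletion ℚ) e₁ -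
      algebraMap ℚ (v.adicCompletion ℚ) e₃) = 1 := by
    rw [← map_sub, adicOddPlace_v_algebraMap]; exact hv₁₃
  have h23 : (adicOddPlace v).v (algebraMap ℚ (v.adicCompletion ℚ) e₂ -
      algebraMap ℚ (v.adicCompletion ℚ) e₃) = 1 := by
    rw [← map_sub, adicOddPlace_v_algebraMap]; exact hv₂₃
  have hPa : twoDescentComponent (W.baseChange (v.adicCompletion ℚ)).toAffine
      (algebraMap ℚ (v.adicCompletion ℚ) e₁) (algebraMap ℚ (v.adicCompletion ℚ) e₂)
      (algebraMap ℚ (v.adicCompletion ℚ) e₃) P = sqClass (algebraMap ℚ (v.adicCompletion ℚ) (a : ℚ)) :=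
    hP₁.trans (mk_unitsMap_eq_sqClass (E' := v.adicCompletion ℚ) a)
  have hPb : twoDescentComponent (W.baseChange (v.adicCompletion ℚ)).toAffine
      (algebraMap ℚ (v.adicCompletion ℚ) e₂) (algebraMap ℚ (v.adicCompletion ℚ) e₁)
      (algebraMap ℚ (v.adicCompletion ℚ) e₃) P = sqClass (algebraMap ℚ (v.adicCompletion ℚ) (b : ℚ)) :=
    hP₂.trans (mk_unitsMap_eq_sqClass (E' := v.adicCompletion ℚ) b)
  have hsplit := h.map (v.adicCompletion ℚ)
  haveI hcz : CharZero (v.adicCompletion ℚ) :=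
    charZero_of_injective_algebraMap (algebraMap ℚ (v.adicCompletion ℚ)).injective
  have key := OddPlace.local_conditions_of_add_of_twoDescentComponent_eq (𝔳 := adicOddPlace v)
    hsplit h12 h13 h23 P ha0 hb0 hPa hPb
  simp only [← map_sub, ← map_mul] at key
  simp only [adicOddPlace_χ_algebraMap, adicOddPlace_parity_algebraMap] at key
  exact key

end WeierstrassCurve

end
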